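/-
Copyright (c) 2026 the pub-hodgecm-mathlib formalisation cell (harness21).  Prover seat hodgecm-mathlib-A-p03 (g24); LEAD F0P3a-plan (g9) WORD T8-41 «(F4)–(F8) PEN 1»,
architect A-p06 (g26) (MAP v3 §2 (F4)), 2026-09-01.
-/
import Literature.NumberTheory.Rogawski1990.UnitOrbitalIntegralInertCountJPosClosed
import HarnessLib

/-!
# Flicker's Prop. 10 AT THE TORUS LITERAL: the coset count of `(r_i)⁻¹ t_θ r_i` equals `iTen q (N − j) N₊ m`, `j = 2i + θ̄`

Topic `NumberTheory/Rogawski1990` (road «D-N7-inert», MAP v3 (F4), the LAYER B → LAYER C adapter); namespace `Literature.NumberTheory.Automorphic.UnitaryGroup`.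
THEOREMS ONLY: no definition, no named fact, no instance, no notation, no `sorry`; kernel lane.

★ `natCard_cosets_eq_iTen_of_package` (p841402) is Prop. 10 for the abstract corner literal `τ = !![A,0,B₂ϖ^{2j}; 0,b,0; B₂,0,A]`.  LAYER C (Cor. 9 counted, ★ B-p04
p840967; transport B-p12 (g28)) meets it at `τ = (r_i)⁻¹ · t_θ · r_i` with F0P3-p02 (g11)'s literal `t_θ = !![e(a+c), 0, −e(a−c)θ; 0, b, 0; −e(a−c)θ′, 0, e(a+c)]`
(★ `UnitFundamentalLemmaInertFlickerTorus`, `2e = 1`, `θ = ϖ^{θ̄}`, `θ′ = θ⁻¹`, norm-one `a, b, c`) and the radial representative `r_i = diag(ϖ^{−i}, 1, ϖ^{i})`.  This file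
(§1) computes `(r_i)⁻¹ t_θ r_i = !![A,0,B₂ϖ^{2j}; 0,b,0; B₂,0,A]` with `A = e(a+c)`, `B₂ = −e(a−c)·ϖ^{−θ̄}·(ϖ^{−1})^{2i}`, `j = 2i + θ̄`; (§2) reads the valuations
`|B₂| = |ϖ^{N−j}|` (`|a − c| = |ϖ^N|`, `j ≤ N`), `|A − b| = |ϖ^{N₊}|` (`|a + c − 2b| = |ϖ^{N₊}|`), and the σ-defect `|σd − d| = |ϖ|^{j+N₁+N₂−N}` of `d = 2(A−b)∕B₂ = −2ϖ^j (a+c−2b)∕(a−c)`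
(★ `map_ratio_sub_ratio`) together with the ultrametric fact «`N₊ < N ⇒ N₁ = N₂ = N₊`» that makes it `≤ |ϖ^{2m−ν}|` in the fourth regime; (§3) concludes
**`natCard_cosets_flickerTorus_eq_iTen`**: `#{y ∈ P_H ⧸ (P_H ∩ H^K_m) : y⁻¹ (r_i⁻¹ t_θ r_i) y ∈ H^K_m} = iTen q (N − j) N₊ m` — Prop. 10 in the eigenvalue currency
`(N₁, N₂, N, N₊) = (v(a−b), v(c−b), v(a−c), v(a+c−2b))`.
HONEST LABEL: HC_CM is proved only modulo the printed citations until rung 0 closes.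

## References
* [Flicker1998UnitaryFL] Y. Z. Flicker, *Elementary proof of the fundamental lemma for a unitary group*, Canad. J. Math. 50 (1998), 74–98: §4 p. 85 (notation), Prop. 10 pp. 85–86,
  Cor. 9 p. 85 (the integrand `(r_θ^j)⁻¹ t_θ r_θ^j`).
* [Rogawski1990] J. D. Rogawski, *Automorphic Representations of Unitary Groups in Three Variables* (1990), §4.9 p. 55.
-/

set_option autoImplicit false

open scoped MatrixGroups WithZero Valued
open Matrix

namespace Literature.NumberTheory.Automorphic

namespace UnitaryGroup

open Literature.NumberTheory.Automorphic.HermitianLattice (unitaryInt mem_unitaryInt_iff LocalConjDatum)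
open Literature.NumberTheory.Rogawski1990.Flicker1998 (iTen)
open IsLocalRing

variable {K : Type*} [Field K] [Valued K ℤᵐ⁰] {ϖ : K} (σ : K →+* K) {J : Matrix (Fin 3) (Fin 3) K}

/-! ## §1 The conjugate `(r_i)⁻¹ t_θ r_i` -/

omit [Valued K ℤᵐ⁰] in
/-- **`(r_i)⁻¹ · t_θ · r_i = t_{θϖ^{2i}, θ′ϖ^{−2i}}`** for `r_i = diag(ϖ^{−i}, 1, ϖ^i)` — in the corner-literal shape `!![A,0,B₁; 0,b,0; B₂,0,A]` with `A = e(a+c)`,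
`B₁ = −e(a−c)θϖ^{2i}`, `B₂ = −e(a−c)θ′(ϖ⁻¹)^{2i}`. [cite: Flicker1998UnitaryFL, Cor. 9 p. 85; Prop. 6 p. 83] -/
theorem coe_radial_inv_mul_flickerTorus_mul_radial (hϖ : ϖ ≠ 0) {t r : ↥(unitaryGroupOfForm σ J)} {e θ θ' a b c : K} (i : ℕ)
    (hte : ((t : GL (Fin 3) K) : Matrix (Fin 3) (Fin 3) K) = !![e * (a + c), 0, -(e * (a - c) * θ); 0, b, 0; -(e * (a - c) * θ'), 0, e * (a + c)])
    (hr : ((r : GL (Fin 3) K) : Matrix (Fin 3) (Fin 3) K) = !![ϖ⁻¹ ^ i, 0, 0; 0, 1, 0; 0, 0, ϖ ^ i]) :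
    (((r⁻¹ * t * r : ↥(unitaryGroupOfForm σ J)) : GL (Fin 3) K) : Matrix (Fin 3) (Fin 3) K) =
      !![e * (a + c), 0, -(e * (a - c) * θ) * (ϖ ^ i * ϖ ^ i); 0, b, 0; -(e * (a - c) * θ') * (ϖ⁻¹ ^ i * ϖ⁻¹ ^ i), 0, e * (a + c)] := by
  have hpi : ϖ ^ i ≠ 0 := pow_ne_zero _ hϖ
  have key : ((t : GL (Fin 3) K) : Matrix (Fin 3) (Fin 3) K) * ((r : GL (Fin 3) K) : Matrix (Fin 3) (Fin 3) K) =
      ((r : GL (Fin 3) K) : Matrix (Fin 3) (Fin 3) K) *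
        !![e * (a + c), 0, -(e * (a - c) * θ) * (ϖ ^ i * ϖ ^ i); 0, b, 0; -(e * (a - c) * θ') * (ϖ⁻¹ ^ i * ϖ⁻¹ ^ i), 0, e * (a + c)] := by
    rw [hte, hr]
    simp only [Matrix.mul_fin_three]
    ext k l
    fin_cases k <;> fin_cases l <;> simp only [Matrix.of_apply, Matrix.cons_val', Matrix.cons_val_zero, Matrix.cons_val_one,
      Matrix.cons_val_fin_one, Matrix.cons_val, Matrix.empty_val', Fin.mk_one, Fin.zero_eta, Fin.reduceFinMk, mul_zero, zero_mul,
      add_zero, zero_add, mul_one, one_mul, inv_pow]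
    all_goals field_simp
  rw [Subgroup.coe_mul, Subgroup.coe_mul, Units.val_mul, Units.val_mul, Matrix.mul_assoc, key, ← Matrix.mul_assoc, Subgroup.coe_inv,
    Units.inv_mul, Matrix.one_mul]

/-! ## §2 Valuation data of the conjugate -/

/-- **Ultrametric lemma «`N₊ < N ⇒ N₁ = N₂ = N₊`»** (Flicker §4 p. 85: «if `|a′ − c′| < |a′|` then `|a′| = |c′| = |a′ + c′|`», here in the form we use):
if `|x − y| < |x + y|` then `|x| = |y| = |x + y|` (`|2| = 1`: `2x = (x+y) + (x−y)`, `2y = (x+y) − (x−y)`). [cite: Flicker1998UnitaryFL, §4 p. 85] -/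
theorem v_eq_of_v_sub_lt_v_add (h2 : Valued.v (2 : K) = 1) {x y : K} (h : Valued.v (x - y) < Valued.v (x + y)) :
    Valued.v x = Valued.v (x + y) ∧ Valued.v y = Valued.v (x + y) := by
  have hx : Valued.v (2 * x) = Valued.v (x + y) := by
    rw [show 2 * x = (x + y) + (x - y) by ring]; exact Valuation.map_add_eq_of_lt_left _ h
  have hy : Valued.v (2 * y) = Valued.v (x + y) := by
    rw [show 2 * y = (x + y) + (-(x - y)) by ring]
    exact Valuation.map_add_eq_of_lt_left _ (by rwa [Valuation.map_neg])
  rw [map_mul, h2, one_mul] at hx hy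
  exact ⟨hx, hy⟩

/-! ## §3 Prop. 10 at the torus literal -/

section Torus

variable [IsDiscreteValuationRing 𝒪[K]] [Finite (ResidueField 𝒪[K])] [IsAdicComplete (maximalIdeal 𝒪[K]) 𝒪[K]]

/-- **FLICKER'S PROPOSITION 10 AT THE TORUS LITERAL**: for `t_θ = !![e(a+c),0,−e(a−c)θ; 0,b,0; −e(a−c)θ′,0,e(a+c)]` (`2e = 1`, `θ = ϖ^{θ̄}`, `θ′ = θ⁻¹`, norm-one
`a,b,c` with `|a−c| = |ϖ^N|`, `|a+c−2b| = |ϖ^{N₊}|` — `N₁, N₂` are not needed: in the fourth regime `N₁ = N₂ = N₊` is DERIVED ultrametrically) and `r_i = diag(ϖ^{−i},1,ϖ^i)` with `1 ≤ j := 2i + θ̄ ≤ N`: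
`#{y ∈ P_H ⧸ (P_H ∩ H^K_m) : y⁻¹ (r_i⁻¹ t_θ r_i) y ∈ H^K_m} = iTen q (N − j) N₊ m`. [cite: Flicker1998UnitaryFL, Prop. 10 pp. 85–86; Cor. 9 p. 85] -/
theorem natCard_cosets_flickerTorus_eq_iTen (hJ : J = (StdForm.antidiagonal 3).over K) (hd : LocalConjDatum σ ϖ)
    (hσO : ∀ y : 𝒪[K], (σ.comp 𝒪[K].subtype) y ∈ 𝒪[K]) {y : K} (hy : y * σ y = -2)
    {c um t r : ↥(unitaryGroupOfForm σ J)} (hc : ((c : GL (Fin 3) K) : Matrix (Fin 3) (Fin 3) K) = !![1, 0, 0; 0, -1, 0; 0, 0, 1])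
    {m : ℕ} (hum : ((um : GL (Fin 3) K) : Matrix (Fin 3) (Fin 3) K) = !![ϖ ^ m, y, (ϖ ^ m)⁻¹; 0, 1, -σ y * (ϖ ^ m)⁻¹; 0, 0, (ϖ ^ m)⁻¹])
    {e θ θ' a b cc : K} (h2e : 2 * e = 1) {θbar : ℕ} (hθ : θ = ϖ ^ θbar) (hθ' : θ' = (ϖ ^ θbar)⁻¹)
    (ha : σ a * a = 1) (hb : σ b * b = 1) (hcc : σ cc * cc = 1)
    (hte : ((t : GL (Fin 3) K) : Matrix (Fin 3) (Fin 3) K) = !![e * (a + cc), 0, -(e * (a - cc) * θ); 0, b, 0; -(e * (a - cc) * θ'), 0, e * (a + cc)])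
    (htH : t ∈ Subgroup.centralizer ({c} : Set ↥(unitaryGroupOfForm σ J)))
    {i : ℕ} (hr : ((r : GL (Fin 3) K) : Matrix (Fin 3) (Fin 3) K) = !![ϖ⁻¹ ^ i, 0, 0; 0, 1, 0; 0, 0, ϖ ^ i])
    (hrH : r ∈ Subgroup.centralizer ({c} : Set ↥(unitaryGroupOfForm σ J)))
    {N Np : ℕ} (hN : Valued.v (a - cc) = Valued.v (ϖ ^ N)) (hNp : Valued.v (a + cc - 2 * b) = Valued.v (ϖ ^ Np))
    (hj : 1 ≤ 2 * i + θbar) (hjN : 2 * i + θbar ≤ N)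
    {q : ℕ} (hq : Nat.card (ResidueField 𝒪[K]) = q ^ 2)
    {a₀ : 𝒪[K]} (ha₀ : IsUnit (((σ.comp 𝒪[K].subtype).codRestrict 𝒪[K] hσO) a₀ - a₀)) :
    (Nat.card {w : ↥(flickerPH σ J c) ⧸ (flickerHK σ J c um).subgroupOf (flickerPH σ J c) //
      ((Quotient.out w : ↥(flickerPH σ J c)) : ↥(unitaryGroupOfForm σ J))⁻¹ * (r⁻¹ * t * r) * (Quotient.out w : ↥(flickerPH σ J c)) ∈
        flickerHK σ J c um} : ℚ) = iTen q (N - (2 * i + θbar)) Np m := by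
  have h2v : Valued.v (2 : K) = 1 := hd.v2
  have h2 : (2 : K) ≠ 0 := fun h => by rw [h, map_zero] at h2v; exact zero_ne_one h2v
  have hϖ0 : ϖ ≠ 0 := hd.ϖ_ne_zero
  have he0 : e ≠ 0 := fun h => by rw [h, mul_zero] at h2e; exact zero_ne_one h2e
  have hve : Valued.v e = 1 := by
    have := congrArg Valued.v h2e; rw [map_mul, h2v, one_mul, map_one] at this; exact this
  have ha0 : a ≠ 0 := fun h => by rw [h, mul_zero] at ha; exact zero_ne_one ha
  have hb0 : b ≠ 0 := fun h => by rw [h, mul_zero] at hb; exact zero_ne_one hb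
  have hc0 : cc ≠ 0 := fun h => by rw [h, mul_zero] at hcc; exact zero_ne_one hcc
  have hvb : Valued.v b = 1 := by
    have h1 := congrArg Valued.v hb; rw [map_mul, hd.vσ, map_one] at h1
    exact Literature.NumberTheory.QuadraticForms.OMeara65.WithZeroMulInt.eq_one_of_mul_self h1
  have hac : a ≠ cc := by
    intro h; rw [h, sub_self, map_zero] at hN; exact (pow_ne_zero _ hϖ0) ((map_eq_zero _).1 hN.symm)
  have hac' : a - cc ≠ 0 := sub_ne_zero.2 hac
  have hpi : ϖ ^ i ≠ 0 := pow_ne_zero _ hϖ0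
  have hpθ : ϖ ^ θbar ≠ 0 := pow_ne_zero _ hϖ0
  -- §1: the conjugate in corner shape, `B₂ := −e(a−c)θ′(ϖ⁻¹)^{2i}`
  have h02 : -(e * (a - cc) * θ) * (ϖ ^ i * ϖ ^ i) =
      (-(e * (a - cc) * θ') * (ϖ⁻¹ ^ i * ϖ⁻¹ ^ i)) * ϖ ^ (2 * (2 * i + θbar)) := by
    rw [hθ, hθ', inv_pow]
    field_simp
    ring
  have hτ : (((r⁻¹ * t * r : ↥(unitaryGroupOfForm σ J)) : GL (Fin 3) K) : Matrix (Fin 3) (Fin 3) K) =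
      !![e * (a + cc), 0, (-(e * (a - cc) * θ') * (ϖ⁻¹ ^ i * ϖ⁻¹ ^ i)) * ϖ ^ (2 * (2 * i + θbar)); 0, b, 0;
         -(e * (a - cc) * θ') * (ϖ⁻¹ ^ i * ϖ⁻¹ ^ i), 0, e * (a + cc)] := by
    rw [coe_radial_inv_mul_flickerTorus_mul_radial σ hϖ0 i hte hr, h02]
  have hτH : r⁻¹ * t * r ∈ Subgroup.centralizer ({c} : Set ↥(unitaryGroupOfForm σ J)) :=
    Subgroup.mul_mem _ (Subgroup.mul_mem _ (Subgroup.inv_mem _ hrH) htH) hrH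
  -- §2: valuations
  have hvB₂ : Valued.v (-(e * (a - cc) * θ') * (ϖ⁻¹ ^ i * ϖ⁻¹ ^ i)) = Valued.v (ϖ ^ (N - (2 * i + θbar))) := by
    have e1 : Valued.v (-(e * (a - cc) * θ') * (ϖ⁻¹ ^ i * ϖ⁻¹ ^ i)) =
        Valued.v (a - cc) * Valued.v θ' * (Valued.v ((ϖ ^ i)⁻¹) * Valued.v ((ϖ ^ i)⁻¹)) := by
      rw [inv_pow]; simp only [Valuation.map_neg, map_mul, hve, one_mul]
    rw [e1, hN, hθ', hd.v_pow_inv, hd.v_pow_inv, hd.v_pow, hd.v_pow, ← WithZero.exp_add, ← WithZero.exp_add, ← WithZero.exp_add,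
      WithZero.exp_inj]
    omega
  have hAb : e * (a + cc) - b = e * (a + cc - 2 * b) := by linear_combination b * h2e
  have hs : Valued.v (e * (a + cc) - b) = Valued.v (ϖ ^ Np) := by
    rw [hAb, map_mul, hve, one_mul, hNp]
  -- the σ-defect of `d = 2(A − b)∕B₂ = −2ϖ^j · (a+c−2b)∕(a−c)`
  have hσa : σ a = a⁻¹ := eq_inv_of_mul_eq_one_left ha
  have hσb : σ b = b⁻¹ := eq_inv_of_mul_eq_one_left hb
  have hσc : σ cc = cc⁻¹ := eq_inv_of_mul_eq_one_left hcc
  have hdform : 2 * (e * (a + cc) - b) / (-(e * (a - cc) * θ') * (ϖ⁻¹ ^ i * ϖ⁻¹ ^ i)) =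
      -2 * ϖ ^ (2 * i + θbar) * ((a + cc - 2 * b) / (a - cc)) := by
    rw [hAb, hθ', inv_pow]
    field_simp
    ring
  have hσd : Np = N - (2 * i + θbar) → m ≤ N - (2 * i + θbar) → N - (2 * i + θbar) < 2 * m →
      Valued.v (σ (2 * (e * (a + cc) - b) / (-(e * (a - cc) * θ') * (ϖ⁻¹ ^ i * ϖ⁻¹ ^ i))) -
        2 * (e * (a + cc) - b) / (-(e * (a - cc) * θ') * (ϖ⁻¹ ^ i * ϖ⁻¹ ^ i))) ≤ Valued.v (ϖ ^ (2 * m - (N - (2 * i + θbar)))) := by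
    intro hNpν hmν hν2m
    have hdiff : σ (2 * (e * (a + cc) - b) / (-(e * (a - cc) * θ') * (ϖ⁻¹ ^ i * ϖ⁻¹ ^ i))) -
        2 * (e * (a + cc) - b) / (-(e * (a - cc) * θ') * (ϖ⁻¹ ^ i * ϖ⁻¹ ^ i)) =
        -2 * ϖ ^ (2 * i + θbar) * (σ ((a + cc - 2 * b) / (a - cc)) - (a + cc - 2 * b) / (a - cc)) := by
      rw [hdform, map_mul, map_mul, map_neg, map_ofNat, map_pow, hd.σϖ]; ring
    rw [hdiff, map_ratio_sub_ratio σ hσa hσb hσc ha0 hb0 hc0 hac]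
    -- `N₁ = N₂ = N₊` from `N₊ = ν < N`
    have hlt : Valued.v ((a - b) - (cc - b)) < Valued.v ((a - b) + (cc - b)) := by
      rw [show (a - b) - (cc - b) = a - cc by ring, show (a - b) + (cc - b) = a + cc - 2 * b by ring, hN, hNp, hd.v_pow, hd.v_pow,
        WithZero.exp_lt_exp]; omega
    obtain ⟨h1, h2'⟩ := v_eq_of_v_sub_lt_v_add h2v hlt
    rw [show (a - b) + (cc - b) = a + cc - 2 * b by ring, hNp] at h1 h2'
    have e2 : Valued.v (-2 * ϖ ^ (2 * i + θbar) * (2 * (a - b) * (cc - b) / (b * (a - cc)))) =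
        Valued.v (ϖ ^ (2 * i + θbar)) * (Valued.v (a - b) * Valued.v (cc - b) / Valued.v (a - cc)) := by
      simp only [map_mul, map_div₀, Valuation.map_neg, h2v, hvb, one_mul]
    rw [e2, h1, h2', hN, hd.v_pow, hd.v_pow, hd.v_pow, hd.v_pow, div_eq_mul_inv, ← WithZero.exp_neg, ← WithZero.exp_add,
      ← WithZero.exp_add, ← WithZero.exp_add, WithZero.exp_le_exp]
    omega
  exact natCard_cosets_eq_iTen_of_package σ hJ hd hσO hy hj hc hum hτ hτH hvB₂ hs hσd hq ha₀

end Torus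

end UnitaryGroup

end Literature.NumberTheory.Automorphic
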